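import Summits.KontsevichZagierPeriods.KontsevichZagierPeriods.Theses.SymplecticScissors
import Literature.NumberTheory.Transcendental.SemialgebraicMapsProofs
import Literature.NumberTheory.Transcendental.KZSemialgebraicComplex

/-!
# `FiniteMapShear` (stmt-KontsevichZagierPeriods-9853, route SymplecticScissors)

Generator (B)/(R3) of the planar engine on a monotonicity cell. Data: `a < b`, a function
`φ : ℝ → ℝ` which is `C²` on `(a, b)` with `φ' > 0` there, `x ↦ φ x` and `x ↦ φ' x`
`ℚ`-semialgebraic on `(a, b)`, and `w` `ℚ`-semialgebraic on `φ (a, b)`. Claim: for integrand-`1`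
representations `r` on the subgraph `σ = {(x, y) | x ∈ (a, b), 0 < y < w (φ x) φ' x}` and `r'` on
the subgraph `σ' = {(u, v) | u ∈ φ (a, b), 0 < v < w u}`, `[r] − [r']` is ONE change-of-variables
generator `KZ.changeOfVariablesRel` of the Kontsevich–Zagier calculus [Kontsevich–Zagier 2001,
§1.2, rule (2)].

Proof: the witness is the shear `Φ (x, y) = (φ x, y / φ' x)` with derivative
`Φ' (x, y) = [[φ' x, 0], [−y φ'' x / (φ' x)², 1 / φ' x]]`, `det Φ' = 1`.
* `Φ` is `ℚ`-semialgebraic on `σ`: its coordinates are `φ ∘ pr₀` and `pr₁ / (φ' ∘ pr₀)`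
  (composition with the polynomial projection `pr₀ : ℝ² → ℝ¹`, Tarski–Seidenberg through the
  tree's `IsSemialgebraicFunOn.comp_isSemialgebraicMapOn_holds`, and `IsSemialgebraicFunOn.div`).
* `Φ` is differentiable at every point of `σ` (`φ` is `C²` on the open interval, so `φ` and `φ'`
  are differentiable there), with the displayed derivative (`hasFDerivAt_pi''`, chain and product
  rules) whose determinant is `φ' x · (φ' x)⁻¹ − 0 = 1` (`LinearMap.det_toMatrix'`,
  `Matrix.det_fin_two`).
* `Φ` is injective on `σ`: `φ` is strictly increasing on `(a, b)` (`strictMonoOn_of_deriv_pos`).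
* `Φ '' σ = σ'`: the fibre `(0, w (φ x) φ' x)` over `x` is scaled by `1 / φ' x > 0` onto the fibre
  `(0, w (φ x))` over `φ x`; conversely `(u, v) = Φ (x, v φ' x)` for `u = φ x`.
* integrands: `1 = 1 · |1|`.
No degenerate case bites: where `w (φ x) ≤ 0` both fibres are empty. [Kontsevich–Zagier 2001,
§1.2, rule (2); Bochnak–Coste–Roy 1998, §2.2]
-/

noncomputable section

open MeasureTheory Set
open Literature.NumberTheory.Transcendental
open Literature.NumberTheory.Transcendental.KZ
open Literature.ModelTheory.ExponentialFields (IsSemialgebraic)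
open MvPolynomial (aeval X)

/-! ### Record of the dropped route item `FiniteMapShear` (fullbuild repair 2026-08-16)

The route `SymplecticScissors` dropped its (proved) support item `FiniteMapShear`
(stmt-KontsevichZagierPeriods-9853, closed `proved` by `finiteMapShear_proof` below) on
2026-08-16T14:21:34Z, so the gate-written route file `Theses/SymplecticScissors.lean` no longer
declares the constant, while this proof file — a Theorems file, append-only, whose statement text
`theorem finiteMapShear_proof : FiniteMapShear` may not change — still names it ("Unknown constant",
full build of 2026-08-16T23:32Z). The constant is re-declared here under its ORIGINAL
fully-qualified name with its ORIGINAL definiens (the item's ledger signature, verbatim), in the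
route file's namespace and `open` context, so that the proof elaborates again (pattern
`Theorems/SwallowTheDatumTargetGlue.lean`, `Theorems/DebrisQuantaRobustDecayQuantumRecord.lean`).
It is NOT a route item (no `route_item` attribute); it is TRUE (proved below). -/

namespace Summit.KontsevichZagierPeriods.KontsevichZagierPeriods.Theses.SymplecticScissors

open scoped BigOperators Topology Manifold Classical MeasureTheory ProbabilityTheory Matrix InnerProductSpace ComplexConjugate ContinuousMap
open Filter Set Function TopologicalSpace MeasureTheory

/-- **Record of the dropped route item `FiniteMapShear`** = stmt-KontsevichZagierPeriods-9853
(ledger signature verbatim; NOT a route item; TRUE — `FiniteMapShear.finiteMapShear_proof`):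
generator (B)/(R3) of the planar engine on a monotonicity cell — for `φ` `ℚ`-semialgebraic and `C²`
with `φ' > 0` on `(a, b)` (`φ'` semialgebraic) and `w` semialgebraic on `φ (a, b)`, the
integrand-`1` representations on the subgraph of `(w ∘ φ) · φ'` over `(a, b)` and on the subgraph
of `w` over `φ (a, b)` differ by ONE change-of-variables generator `KZ.changeOfVariablesRel`
[Kontsevich–Zagier 2001, §1.2, rule (2)]. Re-declared only so that the proof record keeps
elaborating (see the section docstring above). -/
def FiniteMapShear : Prop :=
  ∀ (a b : ℝ) (φ w : ℝ → ℝ), a < b → Literature.NumberTheory.Transcendental.IsSemialgebraicFunOn ℚ {z : Fin 1 → ℝ | z 0 ∈ Set.Ioo a b} (fun z => φ (z 0)) → Literature.NumberTheory.Transcendental.IsSemialgebraicFunOn ℚ {z : Fin 1 → ℝ | z 0 ∈ Set.Ioo a b} (fun z => deriv φ (z 0)) → ContDiffOn ℝ 2 φ (Set.Ioo a b) → (∀ x ∈ Set.Ioo a b, 0 < deriv φ x) → Literature.NumberTheory.Transcendental.IsSemialgebraicFunOn ℚ {z : Fin 1 → ℝ | z 0 ∈ φ '' Set.Ioo a b}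 (fun z => w (z 0)) → ∀ (r r' : Literature.NumberTheory.Transcendental.KZ.IntegralRep 2), r.domain = {p | p 0 ∈ Set.Ioo a b ∧ 0 < p 1 ∧ p 1 < w (φ (p 0)) * deriv φ (p 0)} → r'.domain = {q | q 0 ∈ φ '' Set.Ioo a b ∧ 0 < q 1 ∧ q 1 < w (q 0)} → (∀ p ∈ r.domain, r.integrand p = 1) → (∀ q ∈ r'.domain, r'.integrand q = 1) → Literature.NumberTheory.Transcendental.KZ.of r - Literature.NumberTheory.Transcendental.KZ.of r' ∈ Literature.NumberTheory.Transcendental.KZ.changeOfVariablesRel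

end Summit.KontsevichZagierPeriods.KontsevichZagierPeriods.Theses.SymplecticScissors

namespace Summit.KontsevichZagierPeriods.SymplecticScissors.FiniteMapShear

open Summit.KontsevichZagierPeriods.KontsevichZagierPeriods.Theses.SymplecticScissors (FiniteMapShear)

/-! ### Calculus of the shear `(x, y) ↦ (φ x, y / φ' x)` -/

section Calculus

variable {φ : ℝ → ℝ} {a b : ℝ}

/-- A function which is `C²` on an open interval has derivative `deriv φ x` at each of its points.
[folklore] -/
theorem hasDerivAt_of_contDiffOn_two (hC2 : ContDiffOn ℝ 2 φ (Ioo a b)) {x : ℝ}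
    (hx : x ∈ Ioo a b) : HasDerivAt φ (deriv φ x) x :=
  ((hC2.differentiableOn (by simp) x hx).differentiableAt (isOpen_Ioo.mem_nhds hx)).hasDerivAt

/-- The derivative of a function which is `C²` on an open interval has derivative
`deriv (deriv φ) x` at each of its points. [folklore] -/
theorem hasDerivAt_deriv_of_contDiffOn_two (hC2 : ContDiffOn ℝ 2 φ (Ioo a b)) {x : ℝ}
    (hx : x ∈ Ioo a b) : HasDerivAt (deriv φ) (deriv (deriv φ) x) x := by
  have h1 : ContDiffOn ℝ 1 (deriv φ) (Ioo a b) := hC2.deriv_of_isOpen isOpen_Ioo (by norm_num)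
  exact ((h1.differentiableOn (by simp) x hx).differentiableAt (isOpen_Ioo.mem_nhds hx)).hasDerivAt

/-- **Derivative of the shear.** At a point `p = (x, y)` with `x ∈ (a, b)` and `φ' x ≠ 0`, the shear
`(x, y) ↦ (φ x, y / φ' x)` has derivative `v ↦ (φ' x · v₀, y · (−φ'' x / (φ' x)²) · v₀ + v₁ / φ' x)`
(chain rule for `φ ∘ pr₀` and `(φ')⁻¹ ∘ pr₀`, product rule, assembled coordinatewise by
`hasFDerivAt_pi''`). [folklore] -/
theorem hasFDerivAt_shear (hC2 : ContDiffOn ℝ 2 φ (Ioo a b)) {p : Fin 2 → ℝ} (hp : p 0 ∈ Ioo a b)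
    (hne : deriv φ (p 0) ≠ 0) :
    HasFDerivAt (fun q : Fin 2 → ℝ => (![φ (q 0), q 1 / deriv φ (q 0)] : Fin 2 → ℝ))
      (ContinuousLinearMap.pi
        ![deriv φ (p 0) • ContinuousLinearMap.proj (R := ℝ) (φ := fun _ : Fin 2 => ℝ) 0,
          p 1 • ((-deriv (deriv φ) (p 0) / deriv φ (p 0) ^ 2) •
              ContinuousLinearMap.proj (R := ℝ) (φ := fun _ : Fin 2 => ℝ) 0) +
            (deriv φ (p 0))⁻¹ • ContinuousLinearMap.proj (R := ℝ) (φ := fun _ : Fin 2 => ℝ) 1]) p := by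
  have h0 : HasFDerivAt (fun q : Fin 2 → ℝ => q 0)
      (ContinuousLinearMap.proj (R := ℝ) (φ := fun _ : Fin 2 => ℝ) 0) p := hasFDerivAt_apply 0 p
  have h1 : HasFDerivAt (fun q : Fin 2 → ℝ => q 1)
      (ContinuousLinearMap.proj (R := ℝ) (φ := fun _ : Fin 2 => ℝ) 1) p := hasFDerivAt_apply 1 p
  have hA : HasFDerivAt (fun q : Fin 2 → ℝ => φ (q 0))
      (deriv φ (p 0) • ContinuousLinearMap.proj (R := ℝ) (φ := fun _ : Fin 2 => ℝ) 0) p :=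
    (hasDerivAt_of_contDiffOn_two hC2 hp).comp_hasFDerivAt p h0
  have hψ : HasDerivAt (fun t : ℝ => (deriv φ t)⁻¹) (-deriv (deriv φ) (p 0) / deriv φ (p 0) ^ 2)
      (p 0) := (hasDerivAt_deriv_of_contDiffOn_two hC2 hp).fun_inv hne
  have hB : HasFDerivAt (fun q : Fin 2 → ℝ => (deriv φ (q 0))⁻¹)
      ((-deriv (deriv φ) (p 0) / deriv φ (p 0) ^ 2) •
        ContinuousLinearMap.proj (R := ℝ) (φ := fun _ : Fin 2 => ℝ) 0) p :=
    HasDerivAt.comp_hasFDerivAt (h₂ := fun t : ℝ => (deriv φ t)⁻¹) (f := fun q : Fin 2 → ℝ => q 0)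
      p hψ h0
  have hC : HasFDerivAt (fun q : Fin 2 → ℝ => q 1 * (deriv φ (q 0))⁻¹)
      (p 1 • ((-deriv (deriv φ) (p 0) / deriv φ (p 0) ^ 2) •
          ContinuousLinearMap.proj (R := ℝ) (φ := fun _ : Fin 2 => ℝ) 0) +
        (deriv φ (p 0))⁻¹ • ContinuousLinearMap.proj (R := ℝ) (φ := fun _ : Fin 2 => ℝ) 1) p :=
    h1.fun_mul hB
  have e : (fun q : Fin 2 → ℝ => q 1 / deriv φ (q 0)) = fun q => q 1 * (deriv φ (q 0))⁻¹ :=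
    funext fun q => div_eq_mul_inv _ _
  refine hasFDerivAt_pi'' (Fin.forall_fin_two.mpr ⟨?_, ?_⟩)
  · rw [ContinuousLinearMap.proj_pi]
    simp only [Matrix.cons_val_zero]
    exact hA
  · rw [ContinuousLinearMap.proj_pi]
    simp only [Matrix.cons_val_one, Matrix.cons_val_fin_one]
    rw [e]
    exact hC

/-- **The Jacobian of the shear is `1`**: `det [[c, 0], [y d, c⁻¹]] = c · c⁻¹ − 0 = 1` for `c ≠ 0`
(`LinearMap.det_toMatrix'`, `Matrix.det_fin_two`). [folklore] -/
theorem det_shearDeriv {c d y : ℝ} (hc : c ≠ 0) :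
    (ContinuousLinearMap.pi
        ![c • ContinuousLinearMap.proj (R := ℝ) (φ := fun _ : Fin 2 => ℝ) 0,
          y • (d • ContinuousLinearMap.proj (R := ℝ) (φ := fun _ : Fin 2 => ℝ) 0) +
            c⁻¹ • ContinuousLinearMap.proj (R := ℝ) (φ := fun _ : Fin 2 => ℝ) 1]).det = 1 := by
  rw [ContinuousLinearMap.det, ← LinearMap.det_toMatrix', Matrix.det_fin_two]
  simp [LinearMap.toMatrix'_apply, hc]

/-- A strictly increasing `C²` function: `φ' > 0` on `(a, b)` makes `φ` strictly monotone there
(`strictMonoOn_of_deriv_pos`). [folklore] -/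
theorem strictMonoOn_of_contDiffOn_two (hC2 : ContDiffOn ℝ 2 φ (Ioo a b))
    (hpos : ∀ x ∈ Ioo a b, 0 < deriv φ x) : StrictMonoOn φ (Ioo a b) :=
  strictMonoOn_of_deriv_pos (convex_Ioo a b) hC2.continuousOn (by rw [interior_Ioo]; exact hpos)

end Calculus

/-! ### Semialgebraicity of the shear -/

/-- Pull-back along the first projection: if `z ↦ g (z 0)` is `ℚ`-semialgebraic on
`{z ∈ ℝ¹ | z 0 ∈ s}` and `σ ⊆ ℝ²` is a `ℚ`-semialgebraic set with `p 0 ∈ s` on `σ`, then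
`p ↦ g (p 0)` is `ℚ`-semialgebraic on `σ` (composition with the polynomial map `p ↦ (p 0)`;
Tarski–Seidenberg via `IsSemialgebraicFunOn.comp_isSemialgebraicMapOn_holds`).
[Bochnak–Coste–Roy 1998, Prop. 2.2.6] -/
theorem isSemialgebraicFunOn_comp_fst {σ : Set (Fin 2 → ℝ)} (hσ : IsSemialgebraic ℚ σ)
    {s : Set ℝ} {g : ℝ → ℝ}
    (hg : IsSemialgebraicFunOn ℚ {z : Fin 1 → ℝ | z 0 ∈ s} (fun z => g (z 0)))
    (hmaps : ∀ p ∈ σ, p 0 ∈ s) :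
    IsSemialgebraicFunOn ℚ σ (fun p => g (p 0)) := by
  have hπ : IsSemialgebraicMapOn ℚ σ (fun (p : Fin 2 → ℝ) (_ : Fin 1) => p 0) :=
    (isSemialgebraicMapOn_aeval hσ (fun _ : Fin 1 => (X 0 : MvPolynomial (Fin 2) ℚ))).congr
      (fun p _ => funext fun _ => MvPolynomial.aeval_X _ _)
  have hst : MapsTo (fun (p : Fin 2 → ℝ) (_ : Fin 1) => p 0) σ {z : Fin 1 → ℝ | z 0 ∈ s} :=
    fun p hp => hmaps p hp
  exact IsSemialgebraicFunOn.comp_isSemialgebraicMapOn_holds hg hπ hst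

/-! ### The theorem -/

/-- **`FiniteMapShear`** (stmt-KontsevichZagierPeriods-9853). For `φ` `ℚ`-semialgebraic and `C²`
with `φ' > 0` on `(a, b)` (`φ'` semialgebraic) and `w` semialgebraic on `φ (a, b)`, the shear
`(x, y) ↦ (φ x, y / φ' x)` (`|det| = 1`) is ONE change-of-variables instance of the
Kontsevich–Zagier calculus from the integrand-`1` representation on the subgraph of `(w ∘ φ) · φ'`
over `(a, b)` onto the integrand-`1` representation on the subgraph of `w` over `φ (a, b)`.
[Kontsevich–Zagier 2001, §1.2, rule (2)] -/
theorem finiteMapShear_proof : FiniteMapShear := by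
  intro a b φ w hab hφ hφ' hC2 hpos hw r r' hr hr' hri hri'
  have hne : ∀ x ∈ Ioo a b, deriv φ x ≠ 0 := fun x hx => (hpos x hx).ne'
  have hmono : StrictMonoOn φ (Ioo a b) := strictMonoOn_of_contDiffOn_two hC2 hpos
  have hdom : ∀ p ∈ r.domain, p 0 ∈ Ioo a b ∧ 0 < p 1 ∧ p 1 < w (φ (p 0)) * deriv φ (p 0) := by
    intro p hp
    rw [hr] at hp
    exact hp
  -- the shear and its derivative
  let Φ : (Fin 2 → ℝ) → (Fin 2 → ℝ) := fun q => ![φ (q 0), q 1 / deriv φ (q 0)]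
  let Φ' : (Fin 2 → ℝ) → (Fin 2 → ℝ) →L[ℝ] (Fin 2 → ℝ) := fun p => ContinuousLinearMap.pi
    ![deriv φ (p 0) • ContinuousLinearMap.proj (R := ℝ) (φ := fun _ : Fin 2 => ℝ) 0,
      p 1 • ((-deriv (deriv φ) (p 0) / deriv φ (p 0) ^ 2) •
          ContinuousLinearMap.proj (R := ℝ) (φ := fun _ : Fin 2 => ℝ) 0) +
        (deriv φ (p 0))⁻¹ • ContinuousLinearMap.proj (R := ℝ) (φ := fun _ : Fin 2 => ℝ) 1]
  have hΦ0 : ∀ q, Φ q 0 = φ (q 0) := fun q => rfl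
  have hΦ1 : ∀ q, Φ q 1 = q 1 / deriv φ (q 0) := fun q => rfl
  -- the image of the subgraph of `(w ∘ φ) φ'` is the subgraph of `w`
  have himage : Φ '' r.domain = r'.domain := by
    rw [hr']
    apply Subset.antisymm
    · rintro _ ⟨p, hp, rfl⟩
      obtain ⟨hp0, hp1, hp2⟩ := hdom p hp
      have hd : 0 < deriv φ (p 0) := hpos _ hp0
      refine ⟨⟨p 0, hp0, (hΦ0 p).symm⟩, ?_, ?_⟩
      · rw [hΦ1]
        exact div_pos hp1 hd
      · rw [hΦ1, hΦ0, div_lt_iff₀ hd]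
        exact hp2
    · rintro q ⟨⟨x, hx, hxq⟩, hq1, hq2⟩
      have hd : 0 < deriv φ x := hpos x hx
      refine ⟨![x, q 1 * deriv φ x], ?_, ?_⟩
      · rw [hr]
        refine ⟨?_, ?_, ?_⟩
        · simpa using hx
        · simpa using mul_pos hq1 hd
        · simp only [Matrix.cons_val_zero, Matrix.cons_val_one]
          rw [hxq]
          exact mul_lt_mul_of_pos_right hq2 hd
      · funext i
        fin_cases i
        · simp [hΦ0, hxq]
        · simp [hΦ1, hd.ne']
  -- injectivity: `φ` is strictly increasing
  have hinj : InjOn Φ r.domain := by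
    intro p hp q hq hpq
    obtain ⟨hp0, -, -⟩ := hdom p hp
    obtain ⟨hq0, -, -⟩ := hdom q hq
    have h0 : p 0 = q 0 := by
      have h := congrFun hpq 0
      rw [hΦ0, hΦ0] at h
      exact hmono.injOn hp0 hq0 h
    have h1 : p 1 = q 1 := by
      have h := congrFun hpq 1
      rw [hΦ1, hΦ1, h0] at h
      exact (div_left_inj' (hne _ hq0)).mp h
    funext i
    fin_cases i
    · exact h0
    · exact h1
  -- semialgebraicity
  have hsa : IsSemialgebraicMapOn ℚ r.domain Φ := by
    refine IsSemialgebraicMapOn.of_forall r.isSemialgebraic_domain (Fin.forall_fin_two.mpr ⟨?_, ?_⟩)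
    · simp only [hΦ0]
      exact isSemialgebraicFunOn_comp_fst r.isSemialgebraic_domain hφ (fun p hp => (hdom p hp).1)
    · simp only [hΦ1]
      refine IsSemialgebraicFunOn.div ?_ ?_ (fun p hp => hne _ (hdom p hp).1)
      · exact (isSemialgebraicFunOn_aeval r.isSemialgebraic_domain
          (X 1 : MvPolynomial (Fin 2) ℚ)).congr (fun p _ => MvPolynomial.aeval_X _ _)
      · exact isSemialgebraicFunOn_comp_fst r.isSemialgebraic_domain hφ'
          (fun p hp => (hdom p hp).1)
  -- differentiability and the Jacobian
  have hder : ∀ p ∈ r.domain, HasFDerivWithinAt Φ (Φ' p) r.domain p := by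
    intro p hp
    obtain ⟨hp0, -, -⟩ := hdom p hp
    exact (hasFDerivAt_shear hC2 hp0 (hne _ hp0)).hasFDerivWithinAt
  have hdet : ∀ p ∈ r.domain, (Φ' p).det = 1 := fun p hp =>
    det_shearDeriv (d := -deriv (deriv φ) (p 0) / deriv φ (p 0) ^ 2) (y := p 1)
      (hne _ (hdom p hp).1)
  have hint : ∀ p ∈ r.domain, r.integrand p = r'.integrand (Φ p) * |(Φ' p).det| := by
    intro p hp
    have hp' : Φ p ∈ r'.domain := himage ▸ mem_image_of_mem Φ hp
    rw [hri p hp, hri' _ hp', hdet p hp, abs_one, mul_one]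
  exact ⟨2, r, r', Φ, Φ', hsa, hder, hinj, himage.symm, hint, rfl⟩

end Summit.KontsevichZagierPeriods.SymplecticScissors.FiniteMapShear

end
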